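import Literature.MathematicalPhysics.QuantumFieldTheory.Balaban1983to89.B9Thm312WholeRightStepFrom3131
import Literature.MathematicalPhysics.QuantumFieldTheory.Balaban1983to89.B9BlockNormClassTransfer

/-!
# `Balaban1983to89.B9Thm312WholeRightStepFrom3131C` — [B9] Theorem 3.12 (pp. 421–423): THE RIGHT-FORM STEP MEMBERS `tDd ∕ tDd1`
# (Δ′_πG₀∇\*_{U,μ}, (Δ′_π + Δ⁽²⁾_π)G₀∇\*_{U,μ}) OUT OF A CLASS-LOCALISED INPUT NORM — `tDd_of_letters3131R` with the fibre-localisation transfer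
# `hasMaj_of_dom` REPLACED by dag-n06-d's class-multiplicity transfer (repair «R2-loc» of the located «INPUT-LOC CLASS≠FIBRE»)

T. Bałaban, *Propagators for lattice gauge theories in a background field*, Commun. Math. Phys. **99** (1985) 389–434 [`Balaban1985BackgroundPropagators`,
"B9"]; [4] = T. Bałaban, *Propagators and renormalization transformations for lattice gauge theories. II*, Commun. Math. Phys. **96** (1984) 223–250
[`Balaban1984PropagatorsII`].  statement-level skeleton of published theorems with citation tags; proofs where landed; nothing here is a claim about
the Yang–Mills mass gap.

THE LOCATED DEFECT (dag-n06-w3 g2 `B9Letters313IMBLocObstruction.hLIM_pins_false`, dag-n06-d g9, bus 2026-08-28): the binder `hlocX` of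
`B9Thm312WholeRightStepFrom3131.tDd_of_letters3131R` ∕ `B9Thm312WholeDirB(Z).stepDirB_of_letters3131LR(Z)` (= the field `Letters313IMB.locX`) asks that a
function localised for the input Hölder norm `bHX ε` (print's `supp λ ⊂ Δ̃(y′)`, read at the pins on the CARRIER CLASS of `y′`: n06-d `bHK`, n06-k `RelB`)
be localised on the single FIBRE `𝔬.blk⁻¹ y′` — unsatisfiable at the pins (a carrier block holds up to `2(d+1)` index bonds).  THE REPAIR: the block
majorant of G₀∇\*_{U,μ} is moved from the fibre block sup to `bHX ε` by [4] (2.52)'s block sums — dag-n06-d `B9BlockNormClassTransfer.hasMaj_of_dom_classes_eq`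
— at the cost of the class multiplicity `m`.
* ★ `tDd_of_letters3131RC` — `tDd_of_letters3131R` VERBATIM except: `hdomX hlocX` ↦ a class relation `Rel` on the blocks (multiplicity `m`, `hmult`; carrier
  distance constant on classes, `hRel`) and the two TRUE ε-indexed facts `hvanishX` (fibre pieces of a `bHX ε`-localised `μ` outside the class of `y′` vanish)
  ∕ `hleX` (each fibre piece inside the class has block sup `≤ (bHX ε).loc y′ μ`); constants `(B₀L₀ + B_iD(ε))·t·c` ↦ `(m·B₀L₀ + B_iD(ε))·t·c`.
HONEST SCOPE.  Bookkeeping ([4] (2.52)–(2.54), Lemma 2.1); Theorem 3.3-type entries, (3.44)-type members and the (3.131)∕(3.137) letters remain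
hypotheses; count-neutral; N06 NOT discharged; one finite lattice at a time — nothing continuum ∕ ℝ⁴ ∕ OS ∕ mass gap ∕ Clay.  Cell `pub-ymgap` (HUMAN
RULING D-0062), node N06 [B9], bundle F7 rows 20–21, seat `pub-ymgap-dag-n06-l` (g15), 2026-08-28.  NEW file; nothing landed is modified; 0 `def`.
-/

namespace Literature.MathematicalPhysics.QuantumFieldTheory.Balaban1983to89.B9Thm312WholeRightStepFrom3131C

open Finset B6RandomWalk B6RandomWalkHom B9Thm34Ext B11SectG B9SectDSup B9Thm312Whole B9Thm312WholeLeaf B9Thm312WholeClasses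
open B9RWSums343Holder B9RWSums343to347Whole B9RWSums346Schur B9Thm312WholeDir B9Thm313WholeHolder B9Thm313WholeDir
open B9Thm312WholeStepFrom3131 B9Thm312WholeLeftStepFrom3131 B9Thm312WholeStepDirFrom3131 B9Thm312WholeRightStepFrom3131
open B9BlockNormClassTransfer (hasMaj_of_dom_classes_eq)

noncomputable section

variable {g : B9.Geometry} {B : B9.Backgrounds} {X Y Z W PX PY P : Type}
variable [Fintype X] [Fintype Y] [Fintype Z] [Fintype W] [Fintype PX] [Fintype PY] [Fintype P] [Fintype g.Site]
variable {R₀ : ℝ} {H₀ : Prop}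

omit [Fintype Y] [Fintype Z] [Fintype PX] [Fintype PY] [Fintype P] in
/-- ★ **THE RIGHT-FORM FIELDS `tDd μ ε`, `tDd1 μ ε` OF `StepDir(B)`, ε-INDEXED, OUT OF A CLASS-LOCALISED INPUT NORM** — Δ′_πG₀∇\*_{U,μ} and
(Δ′_π + Δ⁽²⁾_π)G₀∇\*_{U,μ} map `bHX ε` into 𝔠⁽¹⁾ with (m·B₀·L₀ + B_iD(ε))·t·c·e^{−(ρ−αδ)d} resp. twice that, from the (3.42)₃-type component G₀∇\*_{U,μ},
the CLASS-MULTIPLICITY transfer to the input norm (classes of `Rel`, size `≤ m`), the (3.44)-type member D\*G₀∇\*_{U,μ} (`Thm33G0DivR.h44Ds`) and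
`Letters3131R`; αδ ≦ ρ ≦ δ_T, ρ + σ ≦ δ₀.
[cite: Balaban1985BackgroundPropagators, Thm 3.12 p.423 + (3.130)–(3.131) pp.421–422 + (3.137)–(3.138) p.423 + (3.42)–(3.44) pp.397–398; Balaban1984PropagatorsII, (2.52) p.232 + (2.54) p.233 + Lemma 2.1 (2.60)–(2.61) p.234] -/
theorem tDd_of_letters3131RC (hG : GeoOK g) {d : ℕ} {δ α L₀ : ℝ} (hF : Facts347 g R₀ H₀ d δ α L₀) {𝔬 : Ops g B X Y Z W}
    {Dds : B.Cfg → P → Module.End ℝ (X → ℝ)} {bHX : ℝ → BlockNorm (toB6 g R₀ H₀) (X → ℝ)}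
    {bHW : ℝ → BlockNorm (toB6 g R₀ H₀) (W → ℝ)} {Ta Ta₂ : B.Cfg → Module.End ℝ (X → ℝ)}
    {Tb Tb₂ : B.Cfg → (W → ℝ) →ₗ[ℝ] (X → ℝ)} {U : B.Cfg} {B₀ t δ₀ δ₃ δT ρ σ c : ℝ} {BiD BdD : ℝ → ℝ}
    (hrow : RowSum (toB6 g R₀ H₀) σ c) (hB₀ : 0 ≤ B₀) (ht : 0 ≤ t) (hBiD : ∀ ε : ℝ, 0 < ε → 0 ≤ BiD ε)
    (hαρ : α * δ ≤ ρ) (hαδ : 0 ≤ α * δ) (hρT : ρ ≤ δT) (hρ₀ : ρ + σ ≤ δ₀)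
    (he2d : ∀ μ : P, HasMajorantHom (g := toB6 g R₀ H₀) 𝔬.blk 𝔬.blk (𝔬.G0 U ∘ₗ Dds U μ)
      (fun (a b : g.Site) => B₀ * g.len a * Real.exp (-(δ₀ * g.dist a b))))
    (Rel : g.Site → g.Site → Prop) [DecidableRel Rel] {m : ℝ} (hm : 0 ≤ m)
    (hmult : ∀ y' : g.Site, ((Finset.univ.filter (fun y'' => Rel y'' y')).card : ℝ) ≤ m)
    (hRel : ∀ a b b' : g.Site, Rel b' b → g.dist a b' = g.dist a b)
    (hvanishX : ∀ ε : ℝ, 0 < ε → ∀ (y' : g.Site) (μ : X → ℝ), (bHX ε).IsLoc y' μ → ∀ y'' : g.Site, ¬ Rel y'' y' →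
      (BlockNorm.ofBlocks (toB6 g R₀ H₀) 𝔬.blk).cut y'' μ = 0)
    (hleX : ∀ ε : ℝ, 0 < ε → ∀ (y' : g.Site) (μ : X → ℝ), (bHX ε).IsLoc y' μ → ∀ y'' : g.Site, Rel y'' y' →
      (BlockNorm.ofBlocks (toB6 g R₀ H₀) 𝔬.blk).loc y'' ((BlockNorm.ofBlocks (toB6 g R₀ H₀) 𝔬.blk).cut y'' μ) ≤ (bHX ε).loc y' μ)
    (hdiv : Thm33G0DivR 𝔬 Dds R₀ H₀ hG.lenle bHX bHW BiD BdD δ₀ δ₃ U) (hR : Letters3131R 𝔬 Ta Ta₂ Tb Tb₂ R₀ H₀ hG.lenle t δT U)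
    (μ : P) (ε : ℝ) (hε : 0 < ε) :
    HasMaj (bHX ε) (cNormR R₀ H₀ 𝔬.blk hG.lenle 1) (𝔬.Tpi U ∘ₗ (𝔬.G0 U ∘ₗ Dds U μ))
        (fun a b => (m * B₀ * L₀ + BiD ε) * t * c * Real.exp (-((ρ - α * δ) * g.dist a b))) ∧
      HasMaj (bHX ε) (cNormR R₀ H₀ 𝔬.blk hG.lenle 1) ((𝔬.Tpi U + 𝔬.T2 U) ∘ₗ (𝔬.G0 U ∘ₗ Dds U μ))
        (fun a b => 2 * ((m * B₀ * L₀ + BiD ε) * t * c) * Real.exp (-((ρ - α * δ) * g.dist a b))) := by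
  -- G₀∇\*_μ : 𝔠⁽⁰⁾ → 𝔠^{(−1)}, then out of the dominating input class
  have hG1 : HasMaj (cNormR R₀ H₀ 𝔬.blk hG.lenle 0) (cNormR R₀ H₀ 𝔬.blk hG.lenle (-1)) (𝔬.G0 U ∘ₗ Dds U μ)
      (fun a b => B₀ * Real.exp (-(δ₀ * g.dist a b))) :=
    hasMaj_cNormR_of_hasMajorantHom hG (C := fun a b => B₀ * Real.exp (-(δ₀ * g.dist a b)))
      (fun a b => mul_nonneg hB₀ (Real.exp_nonneg _)) 1 0
      (hasMajorantHom_mono (g := toB6 g R₀ H₀) 𝔬.blk 𝔬.blk (he2d μ) fun a b =>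
        le_of_eq (by simp only [Real.rpow_zero, Real.rpow_one, mul_one]; ring))
  -- out of the CLASS-localised input norm by dag-n06-d's class-multiplicity transfer (repair «R2-loc»): the constant picks up `m`
  have hGF : HasMaj (bHX ε) (cNormR R₀ H₀ 𝔬.blk hG.lenle (-1)) (𝔬.G0 U ∘ₗ Dds U μ)
      (fun a b => m * B₀ * Real.exp (-(δ₀ * g.dist a b))) := by
    refine (hasMaj_of_dom_classes_eq Rel (hvanishX ε hε) (hleX ε hε) (fun a b => mul_nonneg hB₀ (Real.exp_nonneg _))
      (fun a b b' hb => by rw [hRel a b b' hb]) hmult (hasMaj_of_in_zero hG1)).mono fun a b => le_of_eq ?_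
    ring
  have hmB₀ : 0 ≤ m * B₀ := mul_nonneg hm hB₀
  have hρa : ρ - α * δ + σ ≤ δ₀ := by linarith
  have hA := rightStep_of_splitR hG hF hrow hmB₀ (hBiD ε hε) ht hαρ hαδ hρT hρa hρa hR.splitR hGF (hdiv.h44Ds μ ε hε) hR.ta hR.tb
  have hB := rightStep_of_splitR hG hF hrow hmB₀ (hBiD ε hε) ht hαρ hαδ hρT hρa hρa hR.splitR₂ hGF (hdiv.h44Ds μ ε hε) hR.ta₂
    hR.tb₂
  refine ⟨hA, ((hA.add hB).congr fun ν => ?_).mono fun a b => le_of_eq ?_⟩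
  · simp only [LinearMap.add_apply, LinearMap.comp_apply]
  · ring

end

end Literature.MathematicalPhysics.QuantumFieldTheory.Balaban1983to89.B9Thm312WholeRightStepFrom3131C
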